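import Mathlib
import Literature.Analysis.FluidPDE.VectorCalculus
import Literature.Analysis.FluidPDE.TaoEnstrophyLocalisation
import Literature.Analysis.FluidPDE.NSVorticityBKMProofs
import HarnessLib

/-!
# t56-SM tools: WHOLE-SPACE INTEGRATION BY PARTS AGAINST A `C¹_c` WEIGHT, and THE TRIVIAL VORTICITY-MOMENT BOUND FROM THE WEIGHTED ENERGY
# (nsreg-p2 ROUND-52 §E / SEEDS-R53 S2, key 06:31:13Z «t56-SM-tools (T1), (T3)» for the small-moment law `NsregP2.R52.Provenance.SmallMomentLaw`
# (r52/Sketch52E.lean 71b4a3bde833b3de); seat ns-sfl-p1 g9, `--supports stmt-NavierStokesRegularity-19832 --as helper`; the law itself = ns-ezl-w3's t56-SM)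

* (T1) `integral_inner_gradient_eq_neg_integral_mul_divergence` — for `F ∈ C¹(E, E)` and a `C¹` compactly supported weight `φ`,
  `∫ ⟪F, ∇φ⟫ = −∫ φ · div F` (coordinatewise integration by parts in an orthonormal frame; the radial cut-offs `φ(|y|/R)` of t56-SM are a special case).
* (T3) `setIntegral_norm_fderiv_sq_le_of_weightedEnergy` — the weighted energy `E_w = ∫ ‖DV‖²‖y‖^{ρ−1} < ∞` (`ρ < 1`) gives
  `∫_{B_R} ‖DV‖² ≤ R^{1−ρ}·E_w`; `setIntegral_rpow_le_of_sq` — Hölder on the ball, `∫_{B_R} f^q ≤ vol(B_R)^{1−q/2}(∫_{B_R} f²)^{q/2}` for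
  continuous `f ≥ 0`, `0 < q ≤ 2`; `setIntegral_norm_curl_rpow_le` — `∫_{B_R}‖curl V‖^q ≤ vol(B_R)^{1−q/2}(16∫_{B_R}‖DV‖²)^{q/2}`
  (`‖curl V‖ ≤ ‖curlCLM‖‖DV‖ ≤ 4‖DV‖`); ★ `smallMoment_trivial_bound` — `∫_{B_R}‖curl V‖^q ≤ (4π/3)^{1−q/2}(16E_w)^{q/2}·R^{3(1−q/2)+(1−ρ)q/2}`.

HONEST FRAMING: class-free calculus tools for an UPPER-bound instrument at the self-similar borderline rate (SEEDS-R53 S2); nothing about the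
crux E (19832 OPEN) or NS regularity is proved here. [nsreg-p2 R52 §E; folklore]
-/

noncomputable section

set_option linter.dupNamespace false

open Set Filter Topology Metric Function MeasureTheory InnerProductSpace
open scoped Topology ENNReal RealInnerProductSpace

namespace Summit.NavierStokesRegularity.NavierStokesRegularity.Theorems.PowerGaugeEulerLiouville

open Literature.Analysis Literature.Analysis.FluidPDE

namespace SmallMoment

/-! ## (T1) Integration by parts against a `C¹_c` weight -/

section IBP

variable {E : Type*} [NormedAddCommGroup E] [InnerProductSpace ℝ E] [FiniteDimensional ℝ E]
  [MeasurableSpace E] [BorelSpace E]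

/-- **(T1) Whole-space integration by parts**: for `F ∈ C¹(E,E)` and `φ ∈ C¹_c(E)`, `∫ ⟪F, ∇φ⟫ = −∫ φ · div F`
(coordinatewise `∫ Fᵢ ∂ᵢφ = −∫ φ ∂ᵢFᵢ` in an orthonormal frame, Mathlib's `integral_bilinear_hasFDerivAt_right_eq_neg_left_of_integrable`;
no boundary term since `φ` has compact support; the proof follows the tree's `VectorCalculus.IsDivFree.isWeaklyDivFree_holds`). [folklore] -/
theorem integral_inner_gradient_eq_neg_integral_mul_divergence {F : E → E} (hF : ContDiff ℝ 1 F) {φ : E → ℝ}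
    (hφ : ContDiff ℝ 1 φ) (hφc : HasCompactSupport φ) :
    ∫ x, ⟪F x, gradient φ x⟫ = -∫ x, φ x * VectorCalculus.divergence F x := by
  set b := stdOrthonormalBasis ℝ E
  have hFc : Continuous F := hF.continuous
  have hDF : Continuous (fderiv ℝ F) := hF.continuous_fderiv one_ne_zero
  have hφcont : Continuous φ := hφ.continuous
  have hDφ : Continuous (fderiv ℝ φ) := hφ.continuous_fderiv one_ne_zero
  -- pointwise expansion in the orthonormal frame `b`
  have hexp : ∀ x, ⟪F x, gradient φ x⟫ = ∑ i, ⟪b i, F x⟫ * fderiv ℝ φ x (b i) := by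
    intro x
    rw [gradient, real_inner_comm, InnerProductSpace.toDual_symm_apply]
    conv_lhs => rw [← b.sum_repr' (F x)]
    simp [map_sum, map_smul, smul_eq_mul]
  -- integrability of the three products (continuous × compactly supported)
  have hI1 : ∀ i, Integrable (fun x => ⟪b i, fderiv ℝ F x (b i)⟫ * φ x) (volume : Measure E) :=
    fun i => ((continuous_const.inner (hDF.clm_apply continuous_const)).mul hφcont)
      |>.integrable_of_hasCompactSupport hφc.mul_left
  have hI2 : ∀ i, Integrable (fun x => ⟪b i, F x⟫ * fderiv ℝ φ x (b i)) (volume : Measure E) :=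
    fun i => ((continuous_const.inner hFc).mul (hDφ.clm_apply continuous_const))
      |>.integrable_of_hasCompactSupport (hφc.fderiv_apply (𝕜 := ℝ) (b i)).mul_left
  have hI3 : ∀ i, Integrable (fun x => ⟪b i, F x⟫ * φ x) (volume : Measure E) :=
    fun i => ((continuous_const.inner hFc).mul hφcont).integrable_of_hasCompactSupport hφc.mul_left
  -- integration by parts, one coordinate at a time
  have hibp : ∀ i, ∫ x, ⟪b i, F x⟫ * fderiv ℝ φ x (b i) =
      -∫ x, ⟪b i, fderiv ℝ F x (b i)⟫ * φ x := by
    intro i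
    have h := integral_bilinear_hasFDerivAt_right_eq_neg_left_of_integrable (μ := (volume : Measure E))
      (f := F) (f' := fderiv ℝ F) (g := φ) (g' := fderiv ℝ φ) (v := b i)
      (B := (ContinuousLinearMap.mul ℝ ℝ).comp (innerSL ℝ (b i)))
      (by simpa using hI1 i) (by simpa using hI2 i) (by simpa using hI3 i)
      (fun x _ => (hF.differentiable one_ne_zero x).hasFDerivAt)
      (fun x _ => (hφ.differentiable one_ne_zero x).hasFDerivAt)
    simpa using h
  have hI4 : Integrable (fun x => φ x * VectorCalculus.divergence F x) (volume : Measure E) := by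
    have hc : Continuous fun x => VectorCalculus.divergence F x := by
      have : ∀ x, VectorCalculus.divergence F x = ∑ i, ⟪b i, fderiv ℝ F x (b i)⟫ :=
        fun x => divergence_eq_sum_inner_fderiv b F x
      simp_rw [this]
      exact continuous_finsetSum _ fun i _ => continuous_const.inner (hDF.clm_apply continuous_const)
    exact (hφcont.mul hc).integrable_of_hasCompactSupport hφc.mul_right
  calc ∫ x, ⟪F x, gradient φ x⟫
      = ∫ x, ∑ i, ⟪b i, F x⟫ * fderiv ℝ φ x (b i) := by simp_rw [hexp]
    _ = ∑ i, ∫ x, ⟪b i, F x⟫ * fderiv ℝ φ x (b i) := integral_finsetSum _ fun i _ => hI2 i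
    _ = -∫ x, ∑ i, ⟪b i, fderiv ℝ F x (b i)⟫ * φ x := by
      rw [integral_finsetSum _ fun i _ => hI1 i, ← Finset.sum_neg_distrib]
      exact Finset.sum_congr rfl fun i _ => hibp i
    _ = -∫ x, φ x * VectorCalculus.divergence F x := by
      congr 1
      refine integral_congr_ae (ae_of_all _ fun x => ?_)
      simp only
      rw [← Finset.sum_mul, ← divergence_eq_sum_inner_fderiv b F x, mul_comm]

end IBP


/-! ## (T3) The trivial vorticity-moment bound from the weighted energy -/

section Moments

/-- Local energy from the weighted energy (`ρ < 1`): on `B(0,R)` the weight `‖y‖^{ρ−1}` is `≥ R^{ρ−1}` (a.e., `y ≠ 0`), so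
`∫⁻_{B_R} ‖DV‖ₑ² ≤ R^{1−ρ} · ∫⁻ ‖DV‖ₑ² ‖y‖^{ρ−1}`. [folklore] -/
theorem setLIntegral_ball_le_of_weightedEnergy {ρ : ℝ} (hρ1 : ρ < 1)
    (V : EuclideanSpace ℝ (Fin 3) → EuclideanSpace ℝ (Fin 3)) {R : ℝ} (hR : 0 < R) :
    ∫⁻ y in ball (0 : EuclideanSpace ℝ (Fin 3)) R, ‖fderiv ℝ V y‖ₑ ^ 2 ≤
      ENNReal.ofReal (R ^ (1 - ρ)) * ∫⁻ y, ‖fderiv ℝ V y‖ₑ ^ 2 * ENNReal.ofReal (‖y‖ ^ (ρ - 1)) := by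
  rw [← lintegral_const_mul' _ _ ENNReal.ofReal_ne_top, ← lintegral_indicator measurableSet_ball]
  refine lintegral_mono_ae ?_
  have h0 : ∀ᵐ y ∂(volume : Measure (EuclideanSpace ℝ (Fin 3))), y ≠ (0 : EuclideanSpace ℝ (Fin 3)) := by
    rw [ae_iff]
    have : {a : EuclideanSpace ℝ (Fin 3) | ¬a ≠ 0} = {0} := by ext a; simp
    rw [this, measure_singleton]
  filter_upwards [h0] with y hy
  by_cases hyR : y ∈ ball (0 : EuclideanSpace ℝ (Fin 3)) R
  · rw [indicator_of_mem hyR]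
    have hy0 : 0 < ‖y‖ := norm_pos_iff.2 hy
    have hyR' : ‖y‖ ≤ R := (mem_ball_zero_iff.1 hyR).le
    have hR1 : 0 ≤ R ^ (1 - ρ) := Real.rpow_nonneg hR.le _
    have key : 1 ≤ R ^ (1 - ρ) * ‖y‖ ^ (ρ - 1) := by
      have h1 : R ^ (ρ - 1) ≤ ‖y‖ ^ (ρ - 1) := Real.rpow_le_rpow_of_nonpos hy0 hyR' (by linarith)
      have h2 : R ^ (1 - ρ) * R ^ (ρ - 1) = 1 := by
        rw [← Real.rpow_add hR, show (1 - ρ) + (ρ - 1) = 0 by ring, Real.rpow_zero]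
      calc (1 : ℝ) = R ^ (1 - ρ) * R ^ (ρ - 1) := h2.symm
        _ ≤ R ^ (1 - ρ) * ‖y‖ ^ (ρ - 1) := mul_le_mul_of_nonneg_left h1 hR1
    calc ‖fderiv ℝ V y‖ₑ ^ 2 = ‖fderiv ℝ V y‖ₑ ^ 2 * ENNReal.ofReal 1 := by rw [ENNReal.ofReal_one, mul_one]
      _ ≤ ‖fderiv ℝ V y‖ₑ ^ 2 * ENNReal.ofReal (R ^ (1 - ρ) * ‖y‖ ^ (ρ - 1)) := by
          gcongr
      _ = ENNReal.ofReal (R ^ (1 - ρ)) * (‖fderiv ℝ V y‖ₑ ^ 2 * ENNReal.ofReal (‖y‖ ^ (ρ - 1))) := by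
          rw [ENNReal.ofReal_mul hR1]; ring
  · rw [indicator_of_notMem hyR]; exact zero_le

/-- **(T3a) `∫_{B_R} ‖DV‖² ≤ R^{1−ρ}·E_w`** for the weighted energy `E_w = ∫ ‖DV‖²‖y‖^{ρ−1} < ∞`, `ρ < 1`, `R > 0` (real form; `V` arbitrary,
`fderiv` is measurable). [folklore] -/
theorem setIntegral_norm_fderiv_sq_le_of_weightedEnergy {ρ : ℝ} (hρ1 : ρ < 1)
    {V : EuclideanSpace ℝ (Fin 3) → EuclideanSpace ℝ (Fin 3)}
    (hE : (∫⁻ y, ‖fderiv ℝ V y‖ₑ ^ 2 * ENNReal.ofReal (‖y‖ ^ (ρ - 1))) ≠ ⊤) {R : ℝ} (hR : 0 < R) :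
    ∫ y in ball (0 : EuclideanSpace ℝ (Fin 3)) R, ‖fderiv ℝ V y‖ ^ 2 ≤
      R ^ (1 - ρ) * (∫⁻ y, ‖fderiv ℝ V y‖ₑ ^ 2 * ENNReal.ofReal (‖y‖ ^ (ρ - 1))).toReal := by
  have h := setLIntegral_ball_le_of_weightedEnergy hρ1 V hR
  have hsm : AEStronglyMeasurable (fun y => ‖fderiv ℝ V y‖ ^ 2)
      (volume.restrict (ball (0 : EuclideanSpace ℝ (Fin 3)) R)) :=
    ((measurable_fderiv ℝ V).norm.pow_const 2).aestronglyMeasurable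
  rw [integral_eq_lintegral_of_nonneg_ae (ae_of_all _ fun _ => sq_nonneg _) hsm]
  have e : ∫⁻ y in ball (0 : EuclideanSpace ℝ (Fin 3)) R, ENNReal.ofReal (‖fderiv ℝ V y‖ ^ 2) =
      ∫⁻ y in ball (0 : EuclideanSpace ℝ (Fin 3)) R, ‖fderiv ℝ V y‖ₑ ^ 2 :=
    lintegral_congr fun y => by rw [← ofReal_norm, ENNReal.ofReal_pow (norm_nonneg _)]
  rw [e, ← ENNReal.toReal_ofReal (Real.rpow_nonneg hR.le (1 - ρ)), ← ENNReal.toReal_mul]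
  exact ENNReal.toReal_mono (ENNReal.mul_ne_top ENNReal.ofReal_ne_top hE) h

/-- The weighted energy makes `‖DV‖²` integrable on every ball. [folklore] -/
theorem integrableOn_norm_fderiv_sq_ball_of_weightedEnergy {ρ : ℝ} (hρ1 : ρ < 1)
    {V : EuclideanSpace ℝ (Fin 3) → EuclideanSpace ℝ (Fin 3)}
    (hE : (∫⁻ y, ‖fderiv ℝ V y‖ₑ ^ 2 * ENNReal.ofReal (‖y‖ ^ (ρ - 1))) ≠ ⊤) {R : ℝ} (hR : 0 < R) :
    IntegrableOn (fun y => ‖fderiv ℝ V y‖ ^ 2) (ball (0 : EuclideanSpace ℝ (Fin 3)) R) := by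
  have h := setLIntegral_ball_le_of_weightedEnergy hρ1 V hR
  refine ⟨((measurable_fderiv ℝ V).norm.pow_const 2).aestronglyMeasurable, ?_⟩
  rw [hasFiniteIntegral_iff_enorm]
  have e : ∫⁻ y in ball (0 : EuclideanSpace ℝ (Fin 3)) R, ‖‖fderiv ℝ V y‖ ^ 2‖ₑ =
      ∫⁻ y in ball (0 : EuclideanSpace ℝ (Fin 3)) R, ‖fderiv ℝ V y‖ₑ ^ 2 :=
    lintegral_congr fun y => by
      rw [Real.enorm_eq_ofReal (sq_nonneg _), ← ofReal_norm, ENNReal.ofReal_pow (norm_nonneg _)]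
  rw [e]
  exact h.trans_lt (ENNReal.mul_lt_top ENNReal.ofReal_lt_top hE.lt_top)

/-- **Hölder on a set of finite measure**: for measurable `f ≥ 0` with `f²` integrable on `s` and `0 < q ≤ 2`,
`∫_s f^q ≤ vol(s)^{1−q/2} · (∫_s f²)^{q/2}` (Mathlib's `ENNReal.lintegral_mul_le_Lp_mul_Lq` with exponents `2/q`, `(1−q/2)⁻¹` against `1`). [folklore] -/
theorem setIntegral_rpow_le_of_sq {f : EuclideanSpace ℝ (Fin 3) → ℝ} {s : Set (EuclideanSpace ℝ (Fin 3))}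
    (hsfin : volume s ≠ ⊤) (hf0 : ∀ y, 0 ≤ f y) (hfm : Measurable f)
    (hf2 : IntegrableOn (fun y => f y ^ 2) s) {q : ℝ} (hq : 0 < q) (hq2 : q ≤ 2) :
    ∫ y in s, f y ^ q ≤ (volume s).toReal ^ (1 - q / 2) * (∫ y in s, f y ^ 2) ^ (q / 2) := by
  rcases eq_or_lt_of_le hq2 with h2 | h2
  · subst h2
    have e : ∀ y, f y ^ (2 : ℝ) = f y ^ (2 : ℕ) := fun y => Real.rpow_two (f y)
    simp_rw [e]
    norm_num
  -- `q < 2`: Hölder in `ℝ≥0∞`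
  set μ := (volume : Measure (EuclideanSpace ℝ (Fin 3))).restrict s with hμ
  have hPQ : (q / 2)⁻¹.HolderConjugate (1 - q / 2)⁻¹ :=
    Real.HolderConjugate.inv_inv (by positivity) (by linarith) (by ring)
  have hF : AEMeasurable (fun y => ENNReal.ofReal (f y ^ q)) μ :=
    (hfm.pow_const q).ennreal_ofReal.aemeasurable
  have hH := ENNReal.lintegral_mul_le_Lp_mul_Lq μ hPQ hF aemeasurable_const (g := fun _ => 1)
  -- evaluate the three lintegrals
  have hfq_int : Integrable (fun y => f y ^ q) μ := by
    -- `f^q ≤ 1 + f²`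
    have hb : ∀ y, f y ^ q ≤ 1 + f y ^ 2 := by
      intro y
      rcases le_or_gt (f y) 1 with h1 | h1
      · have : f y ^ q ≤ 1 := Real.rpow_le_one (hf0 y) h1 hq.le
        nlinarith [sq_nonneg (f y)]
      · have : f y ^ q ≤ f y ^ (2 : ℝ) := Real.rpow_le_rpow_of_exponent_le h1.le hq2
        rw [Real.rpow_two] at this
        linarith
    haveI : IsFiniteMeasure μ := ⟨by rw [hμ, Measure.restrict_apply_univ]; exact hsfin.lt_top⟩
    refine Integrable.mono' ((integrable_const (1 : ℝ)).add hf2) (hfm.pow_const q).aestronglyMeasurable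
      (ae_of_all _ fun y => ?_)
    rw [Real.norm_eq_abs, abs_of_nonneg (Real.rpow_nonneg (hf0 y) q)]
    exact hb y
  have e1 : ∫⁻ y, ENNReal.ofReal (f y ^ q) ∂μ = ENNReal.ofReal (∫ y in s, f y ^ q) := by
    rw [ofReal_integral_eq_lintegral_ofReal hfq_int (ae_of_all _ fun y => Real.rpow_nonneg (hf0 y) q)]
  simp only [Pi.mul_apply, mul_one] at hH
  have e2 : ∫⁻ y, (ENNReal.ofReal (f y ^ q)) ^ (q / 2)⁻¹ ∂μ = ENNReal.ofReal (∫ y in s, f y ^ 2) := by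
    have : ∀ y, (ENNReal.ofReal (f y ^ q)) ^ (q / 2)⁻¹ = ENNReal.ofReal (f y ^ 2) := by
      intro y
      rw [ENNReal.ofReal_rpow_of_nonneg (Real.rpow_nonneg (hf0 y) q) (by positivity), ← Real.rpow_mul (hf0 y),
        show q * (q / 2)⁻¹ = (2 : ℕ) by field_simp; push_cast; ring, Real.rpow_natCast]
    simp_rw [this]
    rw [ofReal_integral_eq_lintegral_ofReal hf2 (ae_of_all _ fun y => sq_nonneg _)]
  have e3 : ∫⁻ _y, (1 : ℝ≥0∞) ^ (1 - q / 2)⁻¹ ∂μ = volume s := by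
    rw [ENNReal.one_rpow, lintegral_const, hμ, Measure.restrict_apply_univ, one_mul]
  rw [e1, e2, e3] at hH
  -- pass to real numbers
  have hI0 : 0 ≤ ∫ y in s, f y ^ q := integral_nonneg fun y => Real.rpow_nonneg (hf0 y) q
  have hJ0 : 0 ≤ ∫ y in s, f y ^ 2 := integral_nonneg fun y => sq_nonneg _
  have hfin : ENNReal.ofReal (∫ y in s, f y ^ 2) ^ (1 / (q / 2)⁻¹) * volume s ^ (1 / (1 - q / 2)⁻¹) ≠ ⊤ :=
    ENNReal.mul_ne_top (ENNReal.rpow_ne_top_of_nonneg (by positivity) ENNReal.ofReal_ne_top)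
      (ENNReal.rpow_ne_top_of_nonneg (by simp only [one_div, inv_inv]; linarith) hsfin)
  have := ENNReal.toReal_mono hfin hH
  rw [ENNReal.toReal_ofReal hI0, ENNReal.toReal_mul, ← ENNReal.toReal_rpow, ← ENNReal.toReal_rpow,
    ENNReal.toReal_ofReal hJ0] at this
  simp only [one_div, inv_inv] at this
  rw [mul_comm]
  exact this

/-- **(T3b) vorticity moments from local energy**: `∫_{B_R} ‖curl V‖^q ≤ vol(B_R)^{1−q/2}·(16 ∫_{B_R} ‖DV‖²)^{q/2}` for `V ∈ C¹`, `0 < q ≤ 2`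
(`‖curl V‖ ≤ ‖curlCLM‖·‖DV‖ ≤ 4‖DV‖`, Literature `norm_curl_le`, `norm_curlCLM_le_four`; then Hölder). [folklore] -/
theorem setIntegral_norm_curl_rpow_le {V : EuclideanSpace ℝ (Fin 3) → EuclideanSpace ℝ (Fin 3)} (hV : ContDiff ℝ 1 V)
    {R : ℝ} {q : ℝ} (hq : 0 < q) (hq2 : q ≤ 2) :
    ∫ y in ball (0 : EuclideanSpace ℝ (Fin 3)) R, ‖curl V y‖ ^ q ≤
      (volume (ball (0 : EuclideanSpace ℝ (Fin 3)) R)).toReal ^ (1 - q / 2) *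
        (16 * ∫ y in ball (0 : EuclideanSpace ℝ (Fin 3)) R, ‖fderiv ℝ V y‖ ^ 2) ^ (q / 2) := by
  have hDVc : Continuous (fderiv ℝ V) := hV.continuous_fderiv one_ne_zero
  have hcurlc : Continuous (curl V) := by
    rw [curl_eq_curlCLM_comp]; exact curlCLM.continuous.comp hDVc
  have hfin : volume (ball (0 : EuclideanSpace ℝ (Fin 3)) R) ≠ ⊤ := measure_ball_lt_top.ne
  -- integrability on the ball (continuous on the compact closed ball)
  have hint : ∀ {g : EuclideanSpace ℝ (Fin 3) → ℝ}, Continuous g →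
      IntegrableOn g (ball (0 : EuclideanSpace ℝ (Fin 3)) R) := fun hg =>
    (hg.continuousOn.integrableOn_compact (isCompact_closedBall _ _)).mono_set ball_subset_closedBall
  have h1 := setIntegral_rpow_le_of_sq hfin (fun y => norm_nonneg (curl V y)) hcurlc.norm.measurable
    (hint (hcurlc.norm.pow 2)) hq hq2
  -- `‖curl V‖² ≤ 16 ‖DV‖²`
  have hptw : ∀ y, ‖curl V y‖ ^ 2 ≤ 16 * ‖fderiv ℝ V y‖ ^ 2 := by
    intro y
    have h := (norm_curl_le V y).trans (mul_le_mul_of_nonneg_right norm_curlCLM_le_four (norm_nonneg _))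
    nlinarith [norm_nonneg (curl V y), norm_nonneg (fderiv ℝ V y)]
  have h2 : ∫ y in ball (0 : EuclideanSpace ℝ (Fin 3)) R, ‖curl V y‖ ^ 2 ≤
      16 * ∫ y in ball (0 : EuclideanSpace ℝ (Fin 3)) R, ‖fderiv ℝ V y‖ ^ 2 := by
    rw [← integral_const_mul]
    exact setIntegral_mono_on (hint (hcurlc.norm.pow 2)) ((hint (hDVc.norm.pow 2)).const_mul 16)
      measurableSet_ball fun y _ => hptw y
  have h0 : 0 ≤ ∫ y in ball (0 : EuclideanSpace ℝ (Fin 3)) R, ‖curl V y‖ ^ 2 := integral_nonneg fun y => sq_nonneg _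
  calc ∫ y in ball (0 : EuclideanSpace ℝ (Fin 3)) R, ‖curl V y‖ ^ q
      ≤ (volume (ball (0 : EuclideanSpace ℝ (Fin 3)) R)).toReal ^ (1 - q / 2) *
          (∫ y in ball (0 : EuclideanSpace ℝ (Fin 3)) R, ‖curl V y‖ ^ 2) ^ (q / 2) := h1
    _ ≤ (volume (ball (0 : EuclideanSpace ℝ (Fin 3)) R)).toReal ^ (1 - q / 2) *
          (16 * ∫ y in ball (0 : EuclideanSpace ℝ (Fin 3)) R, ‖fderiv ℝ V y‖ ^ 2) ^ (q / 2) := by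
        gcongr

/-- ★ **(T3) THE TRIVIAL MOMENT BOUND** `M_q(R) ≤ |B_R|^{1−q/2}(16 R^{1−ρ} E_w)^{q/2} = (4π/3)^{1−q/2}(16E_w)^{q/2}·R^{3(1−q/2)+(1−ρ)q/2}`:
for `V ∈ C¹` with finite weighted energy `E_w = ∫‖DV‖²‖y‖^{ρ−1}` (`ρ < 1`), every `0 < q ≤ 2` and `R > 0`. [nsreg-p2 R52 §E / SEEDS-R53 S2; folklore] -/
theorem smallMoment_trivial_bound {ρ : ℝ} (hρ1 : ρ < 1) {V : EuclideanSpace ℝ (Fin 3) → EuclideanSpace ℝ (Fin 3)}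
    (hV : ContDiff ℝ 1 V) (hE : (∫⁻ y, ‖fderiv ℝ V y‖ₑ ^ 2 * ENNReal.ofReal (‖y‖ ^ (ρ - 1))) ≠ ⊤)
    {q : ℝ} (hq : 0 < q) (hq2 : q ≤ 2) {R : ℝ} (hR : 0 < R) :
    ∫ y in ball (0 : EuclideanSpace ℝ (Fin 3)) R, ‖curl V y‖ ^ q ≤
      (Real.pi * 4 / 3) ^ (1 - q / 2) *
        (16 * (∫⁻ y, ‖fderiv ℝ V y‖ₑ ^ 2 * ENNReal.ofReal (‖y‖ ^ (ρ - 1))).toReal) ^ (q / 2) *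
          R ^ (3 * (1 - q / 2) + (1 - ρ) * (q / 2)) := by
  set Ew := (∫⁻ y, ‖fderiv ℝ V y‖ₑ ^ 2 * ENNReal.ofReal (‖y‖ ^ (ρ - 1))).toReal with hEw
  have hEw0 : 0 ≤ Ew := ENNReal.toReal_nonneg
  have h1 := setIntegral_norm_curl_rpow_le hV (R := R) hq hq2
  have h2 := setIntegral_norm_fderiv_sq_le_of_weightedEnergy hρ1 hE hR
  have hvol : (volume (ball (0 : EuclideanSpace ℝ (Fin 3)) R)).toReal = R ^ 3 * (Real.pi * 4 / 3) := by
    rw [EuclideanSpace.volume_ball_fin_three, ENNReal.toReal_mul, ← ENNReal.ofReal_pow hR.le, ENNReal.toReal_ofReal (by positivity),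
      ENNReal.toReal_ofReal (by positivity)]
  have hq2' : 0 ≤ 1 - q / 2 := by linarith
  have hI0 : 0 ≤ ∫ y in ball (0 : EuclideanSpace ℝ (Fin 3)) R, ‖fderiv ℝ V y‖ ^ 2 := integral_nonneg fun y => sq_nonneg _
  calc ∫ y in ball (0 : EuclideanSpace ℝ (Fin 3)) R, ‖curl V y‖ ^ q
      ≤ (volume (ball (0 : EuclideanSpace ℝ (Fin 3)) R)).toReal ^ (1 - q / 2) *
          (16 * ∫ y in ball (0 : EuclideanSpace ℝ (Fin 3)) R, ‖fderiv ℝ V y‖ ^ 2) ^ (q / 2) := h1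
    _ ≤ (R ^ 3 * (Real.pi * 4 / 3)) ^ (1 - q / 2) * (16 * (R ^ (1 - ρ) * Ew)) ^ (q / 2) := by
        rw [hvol]
        gcongr
    _ = (Real.pi * 4 / 3) ^ (1 - q / 2) * (16 * Ew) ^ (q / 2) * R ^ (3 * (1 - q / 2) + (1 - ρ) * (q / 2)) := by
        rw [Real.mul_rpow (by positivity) (by positivity), show 16 * (R ^ (1 - ρ) * Ew) = R ^ (1 - ρ) * (16 * Ew) by ring,
          Real.mul_rpow (Real.rpow_nonneg hR.le _) (by positivity), ← Real.rpow_natCast R 3,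
          ← Real.rpow_mul hR.le, ← Real.rpow_mul hR.le, Real.rpow_add hR]
        push_cast
        ring

end Moments

end SmallMoment

end Summit.NavierStokesRegularity.NavierStokesRegularity.Theorems.PowerGaugeEulerLiouville

end
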